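import Literature.NumberTheory.GaloisRepresentations.ContinuousCorestriction
import Literature.NumberTheory.GaloisRepresentations.BlochKatoSelmerGroup
import HarnessLib

/-!
# Restriction of scalars on continuous `H¹`: `H¹_A(G, M) ≅ H¹_ℤ(G, M)`

Topic `NumberTheory/GaloisRepresentations`; namespace `Literature.NumberTheory.GaloisRepresentations`.
For a continuous `A`-linear representation `ρ : ContinuousRep G A M` the tree computes continuous
cohomology in TWO currencies: `continuousCohomology n ρ.toTopRep`, an `A`-module (Mathlib, `TopRep A G`;
e.g. `EulerSystem.H1 T U`, the home of Euler-system classes and of Kato's value datum `Λ`), and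
`ρ.toIntRep.cohomology n = continuousCohomology n ρ.toIntRep.toTopRep`, an abelian group (`TopRep ℤ G`;
`BlochKatoSelmerGroup`, `galoisCohomology`, the home of Selmer structures and of the local conditions).
The continuous crossed homomorphisms are the SAME functions in both currencies and so are the principal
ones; this file records the resulting comparison in degree one:

* `contOneCocycles.toInt ρ : Z¹_A(G, M) →+ Z¹_ℤ(G, M)` (the identity on underlying functions) and its
  inverse `contOneCocycles.ofInt`;
* `liftH1Add X φ hφ : H¹(G, X) →+ Y` — **additive maps out of `H¹` defined on cocycles** (the additive
  companion of the tree's `A`-linear `liftH1ₗ`, needed when the target is not an `A`-module), with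
  `liftH1Add_oneCocycleClass`;
* **`ContinuousRep.H1toInt ρ : H¹_A(G, M) →+ H¹_ℤ(G, M)`**, `[f] ↦ [f]`, with `H1toInt_oneCocycleClass`,
  `H1toInt_injective`, `H1toInt_surjective`, and the additive isomorphism `ContinuousRep.H1toIntEquiv`.

Use (cell `bsd-addord`, crux `KatoKuriharaPortThreeShared`): the defined-Kato package `hK` binds a level
class `y : H1 (tateRep W p) U` (`ℤ_[p]`-currency) next to `ℤ`-currency local classes
(`(tateLocalRep W p v).cohomology 1`, `galoisCohomology`), bridged so far only by hypotheses "computed on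
cocycles" (the binder `hΨ` of `KatoExpStarFiniteLevelAt` (ii)); `H1toInt` is that bridge as a map.
Everything PROVED; three small definitions with `rfl`/class formulas.  NOT here: higher degrees, the
`A`-module structure on the `ℤ`-currency side.

## References
* J.-P. Serre, *Galois Cohomology* (1997), I §2.2 (inhomogeneous cochains; the definition of `H¹` does
  not see the scalars), I §5.1. [SerreGaloisCohomology1997]
* J. Neukirch, A. Schmidt, K. Wingberg, *Cohomology of Number Fields* (2008), II §7 (continuous
  cochains). [NeukirchSchmidtWingberg2008]
-/

noncomputable section

open CategoryTheory

universe u v w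

namespace Literature.NumberTheory.GaloisRepresentations

/-! ## §1. Additive maps out of `H¹` defined on cocycles -/

section LiftAdd

variable {R : Type u} [CommRing R] [TopologicalSpace R]
variable {G : Type v} [Group G] [TopologicalSpace G] [IsTopologicalGroup G]
variable (X : TopRep.{v} R G) {Y : Type w} [AddCommGroup Y]

/-- A map on cocycles killing those of trivial class takes equal values on cohomologous cocycles.
[cite: SerreGaloisCohomology1997, I §2.2] -/
theorem apply_eq_of_oneCocycleClass_eq (φ : contOneCocycles X →+ Y)
    (hφ : ∀ f, oneCocycleClass X f = 0 → φ f = 0) {f f' : contOneCocycles X}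
    (h : oneCocycleClass X f = oneCocycleClass X f') : φ f = φ f' := by
  rw [← sub_eq_zero, ← map_sub]
  exact hφ _ (by rw [oneCocycleClass_sub, h, sub_self])

/-- **Additive maps out of `H¹` defined on cocycles**: an additive map on continuous crossed
homomorphisms that kills those with trivial class descends to `H¹_cont(G, X) = Z¹/B¹` (every class is a
cocycle class, `oneCocycleClass_surjective`).  Additive companion of the tree's `R`-linear `liftH1ₗ`
(`ContinuousCorestriction`), for targets that are not `R`-modules. [cite: SerreGaloisCohomology1997, I §2.2] -/
def liftH1Add (φ : contOneCocycles X →+ Y) (hφ : ∀ f, oneCocycleClass X f = 0 → φ f = 0) :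
    continuousCohomology 1 X →+ Y where
  toFun c := φ (Classical.choose (oneCocycleClass_surjective X c))
  map_zero' := hφ _ (Classical.choose_spec (oneCocycleClass_surjective X 0))
  map_add' c c' := by
    rw [← map_add]
    apply apply_eq_of_oneCocycleClass_eq X φ hφ
    rw [oneCocycleClass_add, Classical.choose_spec (oneCocycleClass_surjective X c),
      Classical.choose_spec (oneCocycleClass_surjective X c'),
      Classical.choose_spec (oneCocycleClass_surjective X (c + c'))]

/-- `liftH1Add φ [f] = φ f`. [cite: SerreGaloisCohomology1997, I §2.2] -/
@[simp] theorem liftH1Add_oneCocycleClass (φ : contOneCocycles X →+ Y)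
    (hφ : ∀ f, oneCocycleClass X f = 0 → φ f = 0) (f : contOneCocycles X) :
    liftH1Add X φ hφ (oneCocycleClass X f) = φ f :=
  apply_eq_of_oneCocycleClass_eq X φ hφ
    (Classical.choose_spec (oneCocycleClass_surjective X (oneCocycleClass X f)))

end LiftAdd

/-! ## §2. Cocycles and `H¹` under restriction of scalars `A ↝ ℤ` -/

namespace ContinuousRep

variable {G : Type u} [Group G] [TopologicalSpace G] [IsTopologicalGroup G]
variable {A : Type v} [CommRing A] [TopologicalSpace A]
variable {M : Type u} [AddCommGroup M] [Module A M] [TopologicalSpace M] [IsTopologicalAddGroup M]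
  [ContinuousSMul A M]
variable (ρ : ContinuousRep G A M)

/-- A continuous crossed homomorphism of the `A`-linear representation `ρ` IS one of the `ℤ`-linear
representation `ρ.toIntRep` (same function, same identity `f(gh) = f(g) + g·f(h)`). [cite: SerreGaloisCohomology1997, I §2.2] -/
def toIntCocycle (f : contOneCocycles ρ.toTopRep) : contOneCocycles ρ.toIntRep.toTopRep :=
  ⟨f.1, fun g h => f.2 g h⟩

/-- … and conversely. [cite: SerreGaloisCohomology1997, I §2.2] -/
def ofIntCocycle (f : contOneCocycles ρ.toIntRep.toTopRep) : contOneCocycles ρ.toTopRep :=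
  ⟨f.1, fun g h => f.2 g h⟩

omit [IsTopologicalGroup G] in
/-- `toIntCocycle` is the identity on underlying functions. [cite: SerreGaloisCohomology1997, I §2.2] -/
@[simp] theorem toIntCocycle_apply (f : contOneCocycles ρ.toTopRep) (g : G) :
    (ρ.toIntCocycle f).1 g = f.1 g := rfl

omit [IsTopologicalGroup G] in
/-- `ofIntCocycle` is the identity on underlying functions. [cite: SerreGaloisCohomology1997, I §2.2] -/
@[simp] theorem ofIntCocycle_apply (f : contOneCocycles ρ.toIntRep.toTopRep) (g : G) :
    (ρ.ofIntCocycle f).1 g = f.1 g := rfl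

omit [IsTopologicalGroup G] in
/-- `toIntCocycle` is additive. [cite: SerreGaloisCohomology1997, I §2.2] -/
theorem toIntCocycle_add (f f' : contOneCocycles ρ.toTopRep) :
    ρ.toIntCocycle (f + f') = ρ.toIntCocycle f + ρ.toIntCocycle f' :=
  Subtype.ext (ContinuousMap.ext fun _ => rfl)

/-- A crossed homomorphism is principal for `ρ` iff it is principal for `ρ.toIntRep` (same `v`).
[cite: SerreGaloisCohomology1997, I §5.1] -/
theorem oneCocycleClass_toIntCocycle_eq_zero_iff (f : contOneCocycles ρ.toTopRep) :
    oneCocycleClass ρ.toIntRep.toTopRep (ρ.toIntCocycle f) = 0 ↔ oneCocycleClass ρ.toTopRep f = 0 := by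
  rw [oneCocycleClass_eq_zero_iff, oneCocycleClass_eq_zero_iff]
  exact ⟨fun ⟨v, hv⟩ => ⟨v, fun g => hv g⟩, fun ⟨v, hv⟩ => ⟨v, fun g => hv g⟩⟩

/-- **Restriction of scalars on `H¹`**: `H1toInt ρ : H¹_A(G, M) →+ H¹_ℤ(G, M)`, `[f] ↦ [f]` — from the
`A`-module `continuousCohomology 1 ρ.toTopRep` (the currency of `EulerSystem.H1`) to the abelian group
`ρ.toIntRep.cohomology 1` (the currency of `BlochKatoSelmerGroup` / `galoisCohomology`).
[cite: SerreGaloisCohomology1997, I §2.2] -/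
def H1toInt : continuousCohomology 1 ρ.toTopRep →+ ρ.toIntRep.cohomology 1 :=
  liftH1Add ρ.toTopRep
    { toFun := fun f => (oneCocycleClass ρ.toIntRep.toTopRep (ρ.toIntCocycle f) : ρ.toIntRep.cohomology 1)
      map_zero' := (oneCocycleClass_eq_zero_iff _ _).mpr ⟨0, fun g => by
        change (0 : M) = ρ.toIntRep.toTopRep.ρ g 0 - 0
        rw [map_zero, sub_zero]⟩
      map_add' := fun f f' => by
        change oneCocycleClass _ (ρ.toIntCocycle (f + f')) = _
        rw [toIntCocycle_add, oneCocycleClass_add]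
        rfl }
    fun f hf => (ρ.oneCocycleClass_toIntCocycle_eq_zero_iff f).mpr hf

/-- `H1toInt [f] = [f]`. [cite: SerreGaloisCohomology1997, I §2.2] -/
@[simp] theorem H1toInt_oneCocycleClass (f : contOneCocycles ρ.toTopRep) :
    ρ.H1toInt (oneCocycleClass ρ.toTopRep f) =
      (oneCocycleClass ρ.toIntRep.toTopRep (ρ.toIntCocycle f) : ρ.toIntRep.cohomology 1) :=
  liftH1Add_oneCocycleClass _ _ _ f

/-- `H1toInt` is injective (a cocycle principal for `ρ.toIntRep` is principal for `ρ`).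
[cite: SerreGaloisCohomology1997, I §5.1] -/
theorem H1toInt_injective : Function.Injective ρ.H1toInt := by
  refine (injective_iff_map_eq_zero _).mpr fun c hc => ?_
  obtain ⟨f, rfl⟩ := oneCocycleClass_surjective ρ.toTopRep c
  rw [H1toInt_oneCocycleClass] at hc
  exact (ρ.oneCocycleClass_toIntCocycle_eq_zero_iff f).mp hc

/-- `H1toInt` is surjective (every `ℤ`-cocycle is an `A`-cocycle). [cite: SerreGaloisCohomology1997, I §2.2] -/
theorem H1toInt_surjective : Function.Surjective ρ.H1toInt := by
  intro c
  obtain ⟨f, rfl⟩ := oneCocycleClass_surjective ρ.toIntRep.toTopRep c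
  exact ⟨oneCocycleClass ρ.toTopRep (ρ.ofIntCocycle f), by
    rw [H1toInt_oneCocycleClass]; exact congrArg _ (Subtype.ext (ContinuousMap.ext fun _ => rfl))⟩

/-- **`H¹_A(G, M) ≃+ H¹_ℤ(G, M)`**: restriction of scalars is an isomorphism on continuous `H¹`.
[cite: SerreGaloisCohomology1997, I §2.2] -/
def H1toIntEquiv : continuousCohomology 1 ρ.toTopRep ≃+ ρ.toIntRep.cohomology 1 :=
  AddEquiv.ofBijective ρ.H1toInt ⟨ρ.H1toInt_injective, ρ.H1toInt_surjective⟩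

/-- `H1toIntEquiv` is `H1toInt`. [cite: SerreGaloisCohomology1997, I §2.2] -/
@[simp] theorem H1toIntEquiv_apply (c : continuousCohomology 1 ρ.toTopRep) :
    ρ.H1toIntEquiv c = ρ.H1toInt c := rfl

/-! ### Levels: `H¹_A(U, M) → H¹_ℤ(U, M)` for a subgroup `U ≤ G` -/

/-- The level representation `ρ|_U` as a `ContinuousRep` (`ρ.restrict` along the inclusion); its `toTopRep`
is the tree's `subgroupRep ρ.toTopRep U` definitionally, so `(ρ.level U).H1toInt` is the restriction of
scalars `EulerSystem.H1 ρ U →+ (ρ.toIntRep.restrict U.subtypeₜ).cohomology 1` on LEVEL cohomology.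
[cite: SerreGaloisCohomology1997, I §2.2] -/
abbrev level (U : Subgroup G) : ContinuousRep U A M := ρ.restrict (subgroupSubtypeHom U)

omit [IsTopologicalGroup G] in
/-- `subgroupRep ρ.toTopRep U` IS `(ρ.level U).toTopRep`. [cite: SerreGaloisCohomology1997, I §2.2] -/
theorem subgroupRep_toTopRep_eq_level (U : Subgroup G) : subgroupRep ρ.toTopRep U = (ρ.level U).toTopRep := rfl

omit [IsTopologicalGroup G] [IsTopologicalAddGroup M] [ContinuousSMul A M] in
/-- `(ρ.level U).toIntRep` IS `ρ.toIntRep` restricted along the inclusion. [cite: SerreGaloisCohomology1997, I §2.2] -/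
theorem toIntRep_level (U : Subgroup G) :
    (ρ.level U).toIntRep = ρ.toIntRep.restrict (subgroupSubtypeHom U) := rfl

end ContinuousRep

end Literature.NumberTheory.GaloisRepresentations

end
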